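import Summits.KontsevichZagierPeriods.KontsevichZagierPeriods.Theorems.HurwitzMicroSectorsHurwitzSectorComplementStubLadderEngineAux3

/-!
# `HurwitzSectorComplement` (stmt-KontsevichZagierPeriods-14341, route HurwitzMicroSectors),
# line `chebyshev-level-deformation`: stub `stub_ladderEngine` (S1) — the ladder engine

One step of the Chebyshev ladder in the half-angle parameter: with `g(v) = 2/(1+v²)`,
`D(v,s) = (1−s)² + v²(1+s)²`, `T(v;s) = ((1−v²) − (1+v²)s)/D`, `U(v;s) = 2v/D`, stage domains
`S n j V` (box coordinates first, then the parameter chain capped by the real algebraic `V`),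
`Ω = ∏ g(vᵢ)`, `P = ∏ xᵢ`, `κ` = last chain entry:
* (T) `[S (m+2) j V, Ω T(κ;P)] − [S (m+2) j V, Ω/(1−P)] + [S (m+1) (j+1) V, Ω' U(κ';P')] ∈ relations`,
* (U) `[S (m+2) j V, Ω U(κ;P)] − [S (m+1) (j+1) V, Ω' T(κ';P')] ∈ relations`.
Each is: Move A (rule (3) in a new parameter `v' ∈ [0, κ]`, primitive the kernel itself,
`T(0;s) = 1/(1−s)`, `U(0;s) = 0`); the BRIDGE proved here first (open the fibres — rule (1), null
faces —, relabel the coordinates — rule (2), a permutation —, identify with the open band of Move B);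
Move B (rule (3) in the last box coordinate, primitive `∓Ω' x K̃(κ'; P'x)` by the certificates
`∂_v T = ∂_s(−g s U)`, `∂_v U = ∂_s(g s T)`). Reference: M. Kontsevich, D. Zagier, *Periods* (2001), §1.2.
-/

noncomputable section

open Set MeasureTheory
open scoped BigOperators ENNReal
open Literature.NumberTheory.Transcendental

namespace Summit.KontsevichZagierPeriods.Theorems.HurwitzMicroSectorsHurwitzSectorComplement

namespace LadderEngine

open Literature.ModelTheory.ExponentialFields (IsSemialgebraic)

/-- **The relabelling** `(x₀,…,x_{m+1}, v₀,…,v_{j−1}, v') ↦ (x₀,…,x_m, v₀,…,v_{j−1}, v', x_{m+1})`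
as an equivalence of index types, with its four defining equations. [folklore] -/
theorem halfAngle_relabel (m j : ℕ) : ∃ e : Fin (m + 2 + j + 1) ≃ Fin (m + 1 + (j + 1) + 1),
    (∀ i : Fin (m + 1), e (Fin.castSucc (Fin.castAdd j (Fin.castSucc i))) =
      Fin.castSucc (Fin.castAdd (j + 1) i)) ∧
    e (Fin.castSucc (Fin.castAdd j (Fin.last (m + 1)))) = Fin.last (m + 1 + (j + 1)) ∧
    (∀ i : Fin j, e (Fin.castSucc (Fin.natAdd (m + 2) i)) =
      Fin.castSucc (Fin.natAdd (m + 1) (Fin.castSucc i))) ∧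
    e (Fin.last (m + 2 + j)) = Fin.castSucc (Fin.natAdd (m + 1) (Fin.last j)) := by
  refine ⟨⟨fun p => ⟨if (p : ℕ) ≤ m then p else if (p : ℕ) = m + 1 then m + j + 2 else p - 1, ?_⟩,
    fun q => ⟨if (q : ℕ) ≤ m then q else if (q : ℕ) = m + j + 2 then m + 1 else q + 1, ?_⟩, ?_, ?_⟩,
    ?_, ?_, ?_, ?_⟩
  · have := p.2; split_ifs <;> omega
  · have := q.2; split_ifs <;> omega
  · intro p; ext; have := p.2; simp only []; split_ifs <;> omega
  · intro q; ext; have := q.2; simp only []; split_ifs <;> omega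
  · intro i; ext; have := i.2
    simp only [Equiv.coe_fn_mk, Fin.val_castSucc, Fin.val_castAdd]; split_ifs <;> omega
  · ext; simp only [Equiv.coe_fn_mk, Fin.val_castSucc, Fin.val_castAdd, Fin.val_last]
    split_ifs <;> omega
  · intro i; ext; have := i.2
    simp only [Equiv.coe_fn_mk, Fin.val_castSucc, Fin.val_natAdd]; split_ifs <;> omega
  · ext; simp only [Equiv.coe_fn_mk, Fin.val_castSucc, Fin.val_natAdd, Fin.val_last]
    split_ifs <;> omega

section Bridge
variable {g : ℝ → ℝ} {S : (n j : ℕ) → ℝ → Set (Fin (n + j) → ℝ)}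
  {Ω P : (n j : ℕ) → (Fin (n + j) → ℝ) → ℝ} {κ : (n j : ℕ) → ℝ → (Fin (n + j) → ℝ) → ℝ}

/-- **The halfAngle_bridge between the two bands.** Given the band representation of Move A (domain
`{z ∈ S (m+2) j V, 0 ≤ v' ≤ κ z}`, integrand `Ω(z) K_v(v'; P z)`): open its fibres, relabel the
coordinates, and identify the result with the OPEN band of Move B over `S (m+1) (j+1) V`
(integrand `Ω⁻(y) K_v(κ' y; P' y · x)`); the band integrand of Move B is absolutely integrable on
the closed band (the two faces `x = 0, 1` are null). [cite: KontsevichZagier2001, §1.2 rules (1), (2)] -/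
theorem halfAngle_bridge
    (hS : ∀ n j V z, z ∈ S n j V ↔ (∀ i : Fin n, z (Fin.castAdd j i) ∈ Set.Ioo (0:ℝ) 1) ∧
      StrictAnti (Fin.cons V (fun i : Fin j => z (Fin.natAdd n i)) : Fin (j + 1) → ℝ) ∧
      0 < (Fin.cons V (fun i : Fin j => z (Fin.natAdd n i)) : Fin (j + 1) → ℝ) (Fin.last j))
    (hΩ : ∀ n j z, Ω n j z = ∏ i : Fin j, g (z (Fin.natAdd n i)))
    (hP : ∀ n j z, P n j z = ∏ i : Fin n, z (Fin.castAdd j i))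
    (hκ : ∀ n j V z, κ n j V z = (Fin.cons V (fun i : Fin j => z (Fin.natAdd n i)) :
      Fin (j + 1) → ℝ) (Fin.last j))
    {V : ℝ} (hV : IsAlgebraic ℚ V) (m j : ℕ) (Kv : ℝ → ℝ → ℝ) (rbA : KZ.IntegralRep (m + 2 + j + 1))
    (hdA : rbA.domain = KZlog.band (S (m + 2) j V) (fun _ => 0) (κ (m + 2) j V))
    (hiA : rbA.integrand = fun w => Ω (m + 2) j (Fin.init w) * Kv (w (Fin.last _)) (P (m + 2) j (Fin.init w))) :
    IntegrableOn
      (fun w : Fin (m + 1 + (j + 1) + 1) → ℝ =>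
        (∏ i : Fin j, g ((Fin.init w) (Fin.natAdd (m + 1) (Fin.castSucc i)))) *
        Kv (κ (m + 1) (j + 1) V (Fin.init w)) (P (m + 1) (j + 1) (Fin.init w) * w (Fin.last _)))
      (KZlog.band (S (m + 1) (j + 1) V) (fun _ => 0) (fun _ => 1)) ∧
    ∃ rbB' : KZ.IntegralRep (m + 1 + (j + 1) + 1),
      rbB'.domain = {w | (Fin.init w : Fin (m + 1 + (j + 1)) → ℝ) ∈ S (m + 1) (j + 1) V ∧ (0 : ℝ) < w (Fin.last _) ∧ w (Fin.last _) < 1} ∧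
      (rbB'.integrand = fun w =>
        (∏ i : Fin j, g ((Fin.init w) (Fin.natAdd (m + 1) (Fin.castSucc i)))) *
          Kv (κ (m + 1) (j + 1) V (Fin.init w)) (P (m + 1) (j + 1) (Fin.init w) * w (Fin.last _))) ∧
      KZ.of rbA - KZ.of rbB' ∈ KZ.relations := by
  set fB : (Fin (m + 1 + (j + 1) + 1) → ℝ) → ℝ := fun w =>
    (∏ i : Fin j, g ((Fin.init w) (Fin.natAdd (m + 1) (Fin.castSucc i)))) *
      Kv (κ (m + 1) (j + 1) V (Fin.init w)) (P (m + 1) (j + 1) (Fin.init w) * w (Fin.last _)) with hfB_def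
  have hB := isSemialgebraic_S hS hV (m + 2) j
  have ha : IsSemialgebraicFunOn ℚ (S (m + 2) j V) (fun _ => (0 : ℝ)) := by
    simpa using isSemialgebraicFunOn_ratCast hB 0
  have hb : IsSemialgebraicFunOn ℚ (S (m + 2) j V) (κ (m + 2) j V) := sa_κ hκ hV (m + 2) j hB
  -- open the `v'`-fibres
  obtain ⟨rbA', hdA', hiA', relOA⟩ := KZ.of_sub_of_restrict_openBand_mem_relations ha hb rbA hdA
  -- relabel
  obtain ⟨e, he1, he2, he3, he4⟩ := halfAngle_relabel m j
  have relR := KZ.of_sub_of_reindex_mem_relations rbA' e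
  -- coordinates of `w ∘ e`
  have c1 : ∀ (w : Fin (m + 1 + (j + 1) + 1) → ℝ) (i : Fin (m + 1)),
      Fin.init (fun i => w (e i)) (Fin.castAdd j (Fin.castSucc i)) = Fin.init w (Fin.castAdd (j + 1) i) :=
    fun w i => by simp only [Fin.init, he1]
  have c2 : ∀ (w : Fin (m + 1 + (j + 1) + 1) → ℝ),
      Fin.init (fun i => w (e i)) (Fin.castAdd j (Fin.last (m + 1))) = w (Fin.last _) :=
    fun w => by simp only [Fin.init, he2]
  have c3 : ∀ (w : Fin (m + 1 + (j + 1) + 1) → ℝ) (i : Fin j),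
      Fin.init (fun i => w (e i)) (Fin.natAdd (m + 2) i) = Fin.init w (Fin.natAdd (m + 1) (Fin.castSucc i)) :=
    fun w i => by simp only [Fin.init, he3]
  have c4 : ∀ (w : Fin (m + 1 + (j + 1) + 1) → ℝ),
      w (e (Fin.last (m + 2 + j))) = Fin.init w (Fin.natAdd (m + 1) (Fin.last j)) :=
    fun w => by simp only [Fin.init, he4]
  -- the integrand after relabelling
  have hfun : ∀ w : Fin (m + 1 + (j + 1) + 1) → ℝ, rbA.integrand (fun i => w (e i)) = fB w := by
    intro w
    rw [hiA, hfB_def]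
    simp only
    rw [hΩ, hP, hP, hκ, Fin.prod_univ_castSucc, Fin.cons_last]
    simp only [c1, c2, c3, c4]
  -- the domain after relabelling
  have key : ∀ w : Fin (m + 1 + (j + 1) + 1) → ℝ,
      (fun i => w (e i)) ∈ {z : Fin (m + 2 + j + 1) → ℝ | (Fin.init z : Fin (m + 2 + j) → ℝ) ∈ S (m + 2) j V ∧
        (fun _ => (0 : ℝ)) (Fin.init z) < z (Fin.last (m + 2 + j)) ∧
        z (Fin.last (m + 2 + j)) < κ (m + 2) j V (Fin.init z)} ↔
      (Fin.init w : Fin (m + 1 + (j + 1)) → ℝ) ∈ S (m + 1) (j + 1) V ∧ (0 : ℝ) < w (Fin.last _) ∧ w (Fin.last _) < 1 := by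
    intro w
    simp only [mem_setOf_eq]
    rw [hS, hS, hκ, cons_eq_snoc V (Fin.natAdd (m + 1)) (Fin.init w), strictAnti_snoc_iff,
      Fin.snoc_last]
    simp only [Fin.forall_fin_succ', c1, c2, c3, c4]
    constructor
    · rintro ⟨⟨⟨hbx, hx⟩, hanti, -⟩, hv0, hv1⟩
      exact ⟨⟨hbx, ⟨hanti, hv1⟩, hv0⟩, hx.1, hx.2⟩
    · rintro ⟨⟨hbx, ⟨hanti, hv1⟩, hv0⟩, hx0, hx1⟩
      exact ⟨⟨⟨hbx, hx0, hx1⟩, hanti, hv0.trans hv1⟩, hv0, hv1⟩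
  have hdom : (rbA'.reindex e).domain =
      {w | (Fin.init w : Fin (m + 1 + (j + 1)) → ℝ) ∈ S (m + 1) (j + 1) V ∧ (0 : ℝ) < w (Fin.last _) ∧ w (Fin.last _) < 1} := by
    ext w
    change (fun i => w (e i)) ∈ rbA'.domain ↔ _
    rw [hdA']
    exact key w
  have hint' : (rbA'.reindex e).integrand = fB := by
    funext w
    change rbA'.integrand (fun i => w (e i)) = fB w
    rw [hiA']
    exact hfun w
  -- the open band of Move B as a representation
  have hOB : IsSemialgebraic ℚ
      {w : Fin (m + 1 + (j + 1) + 1) → ℝ | (Fin.init w : Fin (m + 1 + (j + 1)) → ℝ) ∈ S (m + 1) (j + 1) V ∧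
        (0 : ℝ) < w (Fin.last _) ∧ w (Fin.last _) < 1} :=
    hdom ▸ (rbA'.reindex e).isSemialgebraic_domain
  have hfBs : IsSemialgebraicFunOn ℚ
      {w : Fin (m + 1 + (j + 1) + 1) → ℝ | (Fin.init w : Fin (m + 1 + (j + 1)) → ℝ) ∈ S (m + 1) (j + 1) V ∧
        (0 : ℝ) < w (Fin.last _) ∧ w (Fin.last _) < 1} fB := by
    rw [← hdom, ← hint']
    exact (rbA'.reindex e).isSemialgebraicFunOn_integrand
  have hfBi : IntegrableOn fB
      {w : Fin (m + 1 + (j + 1) + 1) → ℝ | (Fin.init w : Fin (m + 1 + (j + 1)) → ℝ) ∈ S (m + 1) (j + 1) V ∧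
        (0 : ℝ) < w (Fin.last _) ∧ w (Fin.last _) < 1} := by
    rw [← hdom, ← hint']
    exact (rbA'.reindex e).integrableOn
  let rbB' : KZ.IntegralRep (m + 1 + (j + 1) + 1) := ⟨_, fB, hOB, hfBs, hfBi⟩
  have rel8 : KZ.of (rbA'.reindex e) - KZ.of rbB' ∈ KZ.relations :=
    KZ.of_sub_of_mem_relations_of_eqOn hdom.symm fun w _ => by rw [hint']
  -- integrability on the closed band of Move B
  have hnull : volume ({w : Fin (m + 1 + (j + 1) + 1) → ℝ | w (Fin.last _) = 0} ∪
      {w | w (Fin.last _) = 1}) = 0 :=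
    measure_union_null (KZ.volume_setOf_last_eq_zero 0) (KZ.volume_setOf_last_eq_zero 1)
  have hsub : KZlog.band (S (m + 1) (j + 1) V) (fun _ => 0) (fun _ => 1) ⊆
      {w : Fin (m + 1 + (j + 1) + 1) → ℝ | (Fin.init w : Fin (m + 1 + (j + 1)) → ℝ) ∈ S (m + 1) (j + 1) V ∧
        (0 : ℝ) < w (Fin.last _) ∧ w (Fin.last _) < 1} ∪
      ({w : Fin (m + 1 + (j + 1) + 1) → ℝ | w (Fin.last _) = 0} ∪ {w | w (Fin.last _) = 1}) := by
    rintro w ⟨hwS, h0, h1⟩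
    change (0 : ℝ) ≤ w (Fin.last _) at h0
    change w (Fin.last _) ≤ (1 : ℝ) at h1
    rcases h0.lt_or_eq with h0 | h0
    · rcases h1.lt_or_eq with h1 | h1
      · exact Or.inl ⟨hwS, h0, h1⟩
      · exact Or.inr (Or.inr h1)
    · exact Or.inr (Or.inl h0.symm)
  have hint : IntegrableOn fB (KZlog.band (S (m + 1) (j + 1) V) (fun _ => 0) (fun _ => 1)) := by
    refine IntegrableOn.mono_set (hfBi.union ?_) hsub
    rw [IntegrableOn, Measure.restrict_eq_zero.2 hnull]
    exact integrable_zero_measure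
  refine ⟨hint, rbB', rfl, rfl, ?_⟩
  have : KZ.of rbA - KZ.of rbB' =
      (KZ.of rbA - KZ.of rbA') + (KZ.of rbA' - KZ.of (rbA'.reindex e)) +
        (KZ.of (rbA'.reindex e) - KZ.of rbB') := by abel
  rw [this]
  exact KZ.relations.add_mem (KZ.relations.add_mem relOA relR) rel8

end Bridge


variable {g : ℝ → ℝ} {T U : ℝ → ℝ → ℝ} {S : (n j : ℕ) → ℝ → Set (Fin (n + j) → ℝ)}
  {Ω P : (n j : ℕ) → (Fin (n + j) → ℝ) → ℝ} {κ : (n j : ℕ) → ℝ → (Fin (n + j) → ℝ) → ℝ}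

/-- **The T-step** `[S, Ω T(κ;P)] − [S, Ω/(1−P)] + [S', Ω' U(κ';P')] ∈ relations`.
[cite: KontsevichZagier2001, §1.2 rules (1)–(3)] -/
theorem halfAngle_tStep (hg : ∀ v, g v = 2 / (1 + v ^ 2))
    (hT : ∀ v s, T v s = ((1 - v ^ 2) - (1 + v ^ 2) * s) / ((1 - s) ^ 2 + v ^ 2 * (1 + s) ^ 2))
    (hU : ∀ v s, U v s = 2 * v / ((1 - s) ^ 2 + v ^ 2 * (1 + s) ^ 2))
    (hS : ∀ n j V z, z ∈ S n j V ↔ (∀ i : Fin n, z (Fin.castAdd j i) ∈ Set.Ioo (0:ℝ) 1) ∧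
      StrictAnti (Fin.cons V (fun i : Fin j => z (Fin.natAdd n i)) : Fin (j + 1) → ℝ) ∧
      0 < (Fin.cons V (fun i : Fin j => z (Fin.natAdd n i)) : Fin (j + 1) → ℝ) (Fin.last j))
    (hΩ : ∀ n j z, Ω n j z = ∏ i : Fin j, g (z (Fin.natAdd n i)))
    (hP : ∀ n j z, P n j z = ∏ i : Fin n, z (Fin.castAdd j i))
    (hκ : ∀ n j V z, κ n j V z = (Fin.cons V (fun i : Fin j => z (Fin.natAdd n i)) :
      Fin (j + 1) → ℝ) (Fin.last j))
    {V : ℝ} (hV : IsAlgebraic ℚ V) (m j : ℕ) (r : KZ.IntegralRep (m + 2 + j))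
    (hr : r.domain = S (m + 2) j V)
    (hri : EqOn r.integrand (fun z => Ω (m + 2) j z * T (κ (m + 2) j V z) (P (m + 2) j z)) r.domain) :
    ∃ (r₁ : KZ.IntegralRep (m + 2 + j)) (r₂ : KZ.IntegralRep (m + 1 + (j + 1))),
      r₁.domain = S (m + 2) j V ∧
      EqOn r₁.integrand (fun z => Ω (m + 2) j z / (1 - P (m + 2) j z)) r₁.domain ∧
      r₂.domain = S (m + 1) (j + 1) V ∧
      EqOn r₂.integrand (fun z => Ω (m + 1) (j + 1) z * U (κ (m + 1) (j + 1) V z)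
        (P (m + 1) (j + 1) z)) r₂.domain ∧
      KZ.of r - KZ.of r₁ + KZ.of r₂ ∈ KZ.relations := by
  have hB := isSemialgebraic_S hS hV (m + 2) j
  have hB' := isSemialgebraic_S hS hV (m + 1) (j + 1)
  -- Move A (kernel `T`, derivative `∂_v T`)
  obtain ⟨rbA, rdA, hdA, hiA, hdA2, hiA2, relA⟩ := moveA hg hS hΩ hP hκ hV m j T
    (fun v s => -4 * v * (1 - s ^ 2) / ((1 - s) ^ 2 + v ^ 2 * (1 + s) ^ 2) ^ 2)
    (fun s v hD => hasDerivAt_T hT s v hD) (fun s hs c => continuous_T hT hs c)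
    (fun v s hv hs0 hs1 => abs_Tv_le hv hs0 hs1)
    (fun hσ ha hb hD => sa_T hT hσ ha hb hD) (fun hσ ha hb hD => sa_Tv hσ ha hb hD)
  -- the halfAngle_bridge
  obtain ⟨hintB, rbB', hdB', hiB', relAB⟩ := halfAngle_bridge hS hΩ hP hκ hV m j
    (fun v s => -4 * v * (1 - s ^ 2) / ((1 - s) ^ 2 + v ^ 2 * (1 + s) ^ 2) ^ 2) rbA hdA hiA
  -- Move B (primitive `−Ω' x U(κ'; P'x)`)
  obtain ⟨rbB, rdB, hdB, hiB, hdB2, hiB2, relB⟩ := moveB hg hS hΩ hP hκ hV m j (-1) U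
    (fun v s => -4 * v * (1 - s ^ 2) / ((1 - s) ^ 2 + v ^ 2 * (1 + s) ^ 2) ^ 2)
    (fun v p x hD => by
      have h := hasDerivAt_xU hg hU v p x hD
      have hfun : (fun x => (((-1 : ℚ)) : ℝ) * g v * (x * U v (p * x))) =
          fun x => -g v * (x * U v (p * x)) := by
        funext x
        push_cast
        ring
      rw [hfun]
      exact h)
    (fun v hv c p => continuous_xU hU hv c p)
    (fun hσ ha hb hD => sa_U hU hσ ha hb hD) (fun hσ ha hb hD => sa_Tv hσ ha hb hD) hintB
  -- open the `x`-fibres of the band of Move B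
  obtain ⟨rbB'', hdB'', hiB'', relOB⟩ := KZ.of_sub_of_restrict_openBand_mem_relations
    (by simpa using isSemialgebraicFunOn_ratCast hB' 0)
    (by simpa using isSemialgebraicFunOn_ratCast hB' 1) rbB hdB
  have rel8 : KZ.of rbB' - KZ.of rbB'' ∈ KZ.relations :=
    KZ.of_sub_of_mem_relations_of_eqOn (hdB''.trans hdB'.symm) fun w _ => by rw [hiB', hiB'', hiB]
  -- `r₁ = [S, Ω/(1−P)]`
  have hP1 : ∀ z ∈ S (m + 2) j V, P (m + 2) j z < 1 := fun z hz => (P_mem_Ioo hS hP (by omega) hz).2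
  let r₁ : KZ.IntegralRep (m + 2 + j) := ⟨S (m + 2) j V, fun z => Ω (m + 2) j z / (1 - P (m + 2) j z),
    hB, (sa_Ω hg hΩ (m + 2) j hB).div (sa_sub (by simpa using isSemialgebraicFunOn_ratCast hB 1)
      (sa_P hP (m + 2) j hB)) fun z hz => (sub_pos.2 (hP1 z hz)).ne',
    integrableOn_Ω_div hg hS hΩ hP hV m j⟩
  have relAdd : KZ.of r - KZ.of rdA - KZ.of r₁ ∈ KZ.relations := by
    refine KZ.integrandAddRel_subset_relations ⟨_, r, rdA, r₁, hdA2.trans hr.symm, hr.symm, ?_, rfl⟩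
    intro z hz
    have hz' : z ∈ S (m + 2) j V := hr ▸ hz
    rw [Pi.add_apply, hri hz, hiA2]
    simp only
    rw [T_zero hT (hP1 z hz')]
    ring
  -- `r₂ = [S', Ω' U(κ';P')]`
  have hκ0 : ∀ y ∈ S (m + 1) (j + 1) V, κ (m + 1) (j + 1) V y ≠ 0 :=
    fun y hy => (κ_pos hS hκ hy).ne'
  have hD2 : ∀ y ∈ S (m + 1) (j + 1) V, (1 - P (m + 1) (j + 1) y) ^ 2 +
      (κ (m + 1) (j + 1) V y) ^ 2 * (1 + P (m + 1) (j + 1) y) ^ 2 ≠ 0 :=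
    fun y hy => (D_pos_of_ne _ (hκ0 y hy)).ne'
  have hi2 : IntegrableOn (fun y => Ω (m + 1) (j + 1) y * U (κ (m + 1) (j + 1) V y)
      (P (m + 1) (j + 1) y)) (S (m + 1) (j + 1) V) := by
    have h := rdB.integrableOn
    rw [hdB2, hiB2] at h
    exact IntegrableOn.congr_fun (h.const_mul (-1)) (fun y _ => by push_cast; ring)
      (measurableSet_S hS hV _ _)
  let r₂ : KZ.IntegralRep (m + 1 + (j + 1)) := ⟨S (m + 1) (j + 1) V,
    fun y => Ω (m + 1) (j + 1) y * U (κ (m + 1) (j + 1) V y) (P (m + 1) (j + 1) y), hB',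
    sa_mul (sa_Ω hg hΩ (m + 1) (j + 1) hB')
      (sa_U hU hB' (sa_κ hκ hV (m + 1) (j + 1) hB') (sa_P hP (m + 1) (j + 1) hB') hD2), hi2⟩
  have rel9 : KZ.of rdB + KZ.of r₂ ∈ KZ.relations :=
    KZ.of_add_of_mem_relations_of_eqOn_neg hdB2.symm fun y _ => by
      change Ω (m + 1) (j + 1) y * U (κ (m + 1) (j + 1) V y) (P (m + 1) (j + 1) y) = -rdB.integrand y
      rw [hiB2]
      push_cast
      ring
  refine ⟨r₁, r₂, rfl, fun _ _ => rfl, rfl, fun _ _ => rfl, ?_⟩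
  have : KZ.of r - KZ.of r₁ + KZ.of r₂ = (KZ.of r - KZ.of rdA - KZ.of r₁) - (KZ.of rbA - KZ.of rdA) +
      (KZ.of rbA - KZ.of rbB') + (KZ.of rbB' - KZ.of rbB'') - (KZ.of rbB - KZ.of rbB'') +
      (KZ.of rbB - KZ.of rdB) + (KZ.of rdB + KZ.of r₂) := by abel
  rw [this]
  exact add_mem (add_mem (sub_mem (add_mem (add_mem (sub_mem relAdd relA) relAB) rel8) relOB) relB) rel9

/-- **The U-step** `[S, Ω U(κ;P)] − [S', Ω' T(κ';P')] ∈ relations`.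
[cite: KontsevichZagier2001, §1.2 rules (1)–(3)] -/
theorem halfAngle_uStep (hg : ∀ v, g v = 2 / (1 + v ^ 2))
    (hT : ∀ v s, T v s = ((1 - v ^ 2) - (1 + v ^ 2) * s) / ((1 - s) ^ 2 + v ^ 2 * (1 + s) ^ 2))
    (hU : ∀ v s, U v s = 2 * v / ((1 - s) ^ 2 + v ^ 2 * (1 + s) ^ 2))
    (hS : ∀ n j V z, z ∈ S n j V ↔ (∀ i : Fin n, z (Fin.castAdd j i) ∈ Set.Ioo (0:ℝ) 1) ∧
      StrictAnti (Fin.cons V (fun i : Fin j => z (Fin.natAdd n i)) : Fin (j + 1) → ℝ) ∧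
      0 < (Fin.cons V (fun i : Fin j => z (Fin.natAdd n i)) : Fin (j + 1) → ℝ) (Fin.last j))
    (hΩ : ∀ n j z, Ω n j z = ∏ i : Fin j, g (z (Fin.natAdd n i)))
    (hP : ∀ n j z, P n j z = ∏ i : Fin n, z (Fin.castAdd j i))
    (hκ : ∀ n j V z, κ n j V z = (Fin.cons V (fun i : Fin j => z (Fin.natAdd n i)) :
      Fin (j + 1) → ℝ) (Fin.last j))
    {V : ℝ} (hV : IsAlgebraic ℚ V) (m j : ℕ) (r : KZ.IntegralRep (m + 2 + j))
    (hr : r.domain = S (m + 2) j V)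
    (hri : EqOn r.integrand (fun z => Ω (m + 2) j z * U (κ (m + 2) j V z) (P (m + 2) j z)) r.domain) :
    ∃ (r₂ : KZ.IntegralRep (m + 1 + (j + 1))),
      r₂.domain = S (m + 1) (j + 1) V ∧
      EqOn r₂.integrand (fun z => Ω (m + 1) (j + 1) z * T (κ (m + 1) (j + 1) V z)
        (P (m + 1) (j + 1) z)) r₂.domain ∧
      KZ.of r - KZ.of r₂ ∈ KZ.relations := by
  have hB' := isSemialgebraic_S hS hV (m + 1) (j + 1)
  -- Move A (kernel `U`, derivative `∂_v U`)
  obtain ⟨rbA, rdA, hdA, hiA, hdA2, hiA2, relA⟩ := moveA hg hS hΩ hP hκ hV m j U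
    (fun v s => 2 * ((1 - s) ^ 2 - v ^ 2 * (1 + s) ^ 2) / ((1 - s) ^ 2 + v ^ 2 * (1 + s) ^ 2) ^ 2)
    (fun s v hD => hasDerivAt_U hU s v hD) (fun s hs c => continuous_U hU hs c)
    (fun v s _ hs0 hs1 => abs_Uv_le hs0 hs1)
    (fun hσ ha hb hD => sa_U hU hσ ha hb hD) (fun hσ ha hb hD => sa_Uv hσ ha hb hD)
  have relUA : KZ.of r - KZ.of rdA ∈ KZ.relations :=
    KZ.of_sub_of_mem_relations_of_eqOn (hdA2.trans hr.symm) fun z hz => by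
      rw [hri hz, hiA2]
      simp only
      rw [U_zero hU]
      ring
  -- the halfAngle_bridge
  obtain ⟨hintB, rbB', hdB', hiB', relAB⟩ := halfAngle_bridge hS hΩ hP hκ hV m j
    (fun v s => 2 * ((1 - s) ^ 2 - v ^ 2 * (1 + s) ^ 2) / ((1 - s) ^ 2 + v ^ 2 * (1 + s) ^ 2) ^ 2)
    rbA hdA hiA
  -- Move B (primitive `Ω' x T(κ'; P'x)`)
  obtain ⟨rbB, rdB, hdB, hiB, hdB2, hiB2, relB⟩ := moveB hg hS hΩ hP hκ hV m j 1 T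
    (fun v s => 2 * ((1 - s) ^ 2 - v ^ 2 * (1 + s) ^ 2) / ((1 - s) ^ 2 + v ^ 2 * (1 + s) ^ 2) ^ 2)
    (fun v p x hD => by
      have h := hasDerivAt_xT hg hT v p x hD
      have hfun : (fun x => (((1 : ℚ)) : ℝ) * g v * (x * T v (p * x))) =
          fun x => g v * (x * T v (p * x)) := by
        funext x
        push_cast
        ring
      rw [hfun]
      exact h)
    (fun v hv c p => continuous_xT hT hv c p)
    (fun hσ ha hb hD => sa_T hT hσ ha hb hD) (fun hσ ha hb hD => sa_Uv hσ ha hb hD) hintB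
  -- open the `x`-fibres of the band of Move B
  obtain ⟨rbB'', hdB'', hiB'', relOB⟩ := KZ.of_sub_of_restrict_openBand_mem_relations
    (by simpa using isSemialgebraicFunOn_ratCast hB' 0)
    (by simpa using isSemialgebraicFunOn_ratCast hB' 1) rbB hdB
  have rel8 : KZ.of rbB' - KZ.of rbB'' ∈ KZ.relations :=
    KZ.of_sub_of_mem_relations_of_eqOn (hdB''.trans hdB'.symm) fun w _ => by rw [hiB', hiB'', hiB]
  -- `r₂ = [S', Ω' T(κ';P')]`
  have hκ0 : ∀ y ∈ S (m + 1) (j + 1) V, κ (m + 1) (j + 1) V y ≠ 0 :=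
    fun y hy => (κ_pos hS hκ hy).ne'
  have hD2 : ∀ y ∈ S (m + 1) (j + 1) V, (1 - P (m + 1) (j + 1) y) ^ 2 +
      (κ (m + 1) (j + 1) V y) ^ 2 * (1 + P (m + 1) (j + 1) y) ^ 2 ≠ 0 :=
    fun y hy => (D_pos_of_ne _ (hκ0 y hy)).ne'
  have hi2 : IntegrableOn (fun y => Ω (m + 1) (j + 1) y * T (κ (m + 1) (j + 1) V y)
      (P (m + 1) (j + 1) y)) (S (m + 1) (j + 1) V) := by
    have h := rdB.integrableOn
    rw [hdB2, hiB2] at h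
    exact h.congr_fun (fun y _ => by push_cast; ring) (measurableSet_S hS hV _ _)
  let r₂ : KZ.IntegralRep (m + 1 + (j + 1)) := ⟨S (m + 1) (j + 1) V,
    fun y => Ω (m + 1) (j + 1) y * T (κ (m + 1) (j + 1) V y) (P (m + 1) (j + 1) y), hB',
    sa_mul (sa_Ω hg hΩ (m + 1) (j + 1) hB')
      (sa_T hT hB' (sa_κ hκ hV (m + 1) (j + 1) hB') (sa_P hP (m + 1) (j + 1) hB') hD2), hi2⟩
  have rel9 : KZ.of rdB - KZ.of r₂ ∈ KZ.relations :=
    KZ.of_sub_of_mem_relations_of_eqOn (show r₂.domain = rdB.domain from hdB2.symm) fun y _ => by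
      change rdB.integrand y = Ω (m + 1) (j + 1) y * T (κ (m + 1) (j + 1) V y) (P (m + 1) (j + 1) y)
      rw [hiB2]
      push_cast
      ring
  refine ⟨r₂, rfl, fun _ _ => rfl, ?_⟩
  have : KZ.of r - KZ.of r₂ = (KZ.of r - KZ.of rdA) - (KZ.of rbA - KZ.of rdA) +
      (KZ.of rbA - KZ.of rbB') + (KZ.of rbB' - KZ.of rbB'') - (KZ.of rbB - KZ.of rbB'') +
      (KZ.of rbB - KZ.of rdB) + (KZ.of rdB - KZ.of r₂) := by abel
  rw [this]
  exact add_mem (add_mem (sub_mem (add_mem (add_mem (sub_mem relUA relA) relAB) rel8) relOB) relB) rel9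

end LadderEngine

/-- **S1 (ladder engine: the T-step and the U-step), lead gen-1 statement, under the registered
name `stub_ladderEngine_halfAngle`** (the name `stub_ladderEngine` is registered on the crux item with a
different statement by a parallel seat). With `g, T, U` the half-angle kernels (defining equations as
hypotheses), `S n j V ⊆ ℝ^{n+j}` the stage domains, `Ω` the parameter weight `∏ g(vᵢ)`, `P` the product of
the box coordinates and `κ` the kernel parameter (last entry of the chain `V, v₀, …, v_{j−1}`):
(T) `[S, Ω·T(κ;P)] − [S, Ω/(1−P)] + [S', Ω'·U(κ';P')] ∈ relations`, (U) `[S, Ω·U(κ;P)] − [S', Ω'·T(κ';P')] ∈ relations`,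
where `S'` has one box coordinate fewer and one parameter more. Two Newton–Leibniz moves each
(`∂_v T = ∂_s(−g s U)`, `∂_v U = ∂_s(g s T)`, `T(0;s) = 1/(1−s)`, `U(0;s) = 0`), one reindexing, null faces.
[cite: KontsevichZagier2001, §1.2 rules (1)–(3)] -/
theorem stub_ladderEngine_halfAngle : ∀ (g : ℝ → ℝ) (T U : ℝ → ℝ → ℝ) (S : (n j : ℕ) → ℝ → Set (Fin (n + j) → ℝ)) (Ω P : (n j : ℕ) → (Fin (n + j) → ℝ) → ℝ) (κ : (n j : ℕ) → ℝ → (Fin (n + j) → ℝ) → ℝ), (∀ v, g v = 2 / (1 + v ^ 2)) → (∀ v s, T v s = ((1 - v ^ 2) - (1 + v ^ 2) * s) / ((1 - s) ^ 2 + v ^ 2 * (1 + s) ^ 2)) → (∀ v s, U v s = 2 * v / ((1 - s) ^ 2 + v ^ 2 * (1 + s) ^ 2)) → (∀ n j V z, z ∈ S n j V ↔ (∀ i : Fin n, z (Fin.castAdd j i) ∈ Set.Ioo (0:ℝ) 1) ∧ StrictAnti (Fin.cons V (fun i : Fin j => z (Fin.natAdd n i)) : Fin (j + 1) → ℝ)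 ∧ 0 < (Fin.cons V (fun i : Fin j => z (Fin.natAdd n i)) : Fin (j + 1) → ℝ) (Fin.last j)) → (∀ n j z, Ω n j z = ∏ i : Fin j, g (z (Fin.natAdd n i))) → (∀ n j z, P n j z = ∏ i : Fin n, z (Fin.castAdd j i)) → (∀ n j V z, κ n j V z = (Fin.cons V (fun i : Fin j => z (Fin.natAdd n i)) : Fin (j + 1) → ℝ) (Fin.last j)) → ∀ (m j : ℕ) (V : ℝ), IsAlgebraic ℚ V → 0 < V → (∀ (r : KZ.IntegralRep (m + 2 + j)), r.domain = S (m + 2) j V → Set.EqOn r.integrand (fun z => Ω (m + 2) j z * T (κ (m + 2) j V z) (P (m + 2) j z)) r.domain → ∃ (r₁ : KZ.IntegralRep (m + 2 + j)) (r₂ : KZ.IntegralRep (m + 1 + (j + 1))), r₁.domain = S (m + 2) j V ∧ Set.EqOn r₁.integrand (fun z => Ω (m + 2) j z / (1 - P (m + 2) j z)) r₁.domain ∧ r₂.domain = S (m + 1) (j + 1) V ∧ Set.EqOn r₂.integrand (fun z => Ω (m + 1) (j + 1) z * U (κ (m + 1) (j + 1) V z) (P (m + 1) (j + 1) z)) r₂.domain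 ∧ KZ.of r - KZ.of r₁ + KZ.of r₂ ∈ KZ.relations) ∧ (∀ (r : KZ.IntegralRep (m + 2 + j)), r.domain = S (m + 2) j V → Set.EqOn r.integrand (fun z => Ω (m + 2) j z * U (κ (m + 2) j V z) (P (m + 2) j z)) r.domain → ∃ (r₂ : KZ.IntegralRep (m + 1 + (j + 1))), r₂.domain = S (m + 1) (j + 1) V ∧ Set.EqOn r₂.integrand (fun z => Ω (m + 1) (j + 1) z * T (κ (m + 1) (j + 1) V z) (P (m + 1) (j + 1) z)) r₂.domain ∧ KZ.of r - KZ.of r₂ ∈ KZ.relations) := by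
  intro g T U S Ω P κ hg hT hU hS hΩ hP hκ m j V hV _
  exact ⟨fun r hr hri => LadderEngine.halfAngle_tStep hg hT hU hS hΩ hP hκ hV m j r hr hri,
    fun r hr hri => LadderEngine.halfAngle_uStep hg hT hU hS hΩ hP hκ hV m j r hr hri⟩

end Summit.KontsevichZagierPeriods.Theorems.HurwitzMicroSectorsHurwitzSectorComplement

end
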